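/-
Copyright: the b2b-balaban T⁴-continuum CRUX team, row NE7b leaf lineage `t4-ne7b-formalise-leaf-03` (gen 146). Project licence.
-/
import Mathlib.Analysis.Calculus.FDeriv.Basic
import Mathlib.Analysis.Normed.Operator.ContinuousLinearMap
import Mathlib.Analysis.Calculus.LocalExtr.Basic
import Mathlib.Analysis.Calculus.Deriv.Add
import Mathlib.Analysis.Calculus.Deriv.Mul
import Mathlib.Analysis.Calculus.Deriv.Comp

/-!
# THE SECOND-ORDER ENVELOPE THEOREM FOR THE HARD LINEAR CONSTRAINT **ON A WINDOW** (Peano form): the windowed value function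
# `φ_K w = inf {V δ : δ ∈ K, D δ = w}` has at `w₀` the expansion `φ_K (w₀ + h) = φ_K w₀ + V′(N h) + q (N h) + o(‖h‖²)` as soon as the
# constrained minimiser `δ₀` is an INTERIOR point of the window (`K ∈ 𝓝 δ₀`) and `V` obeys the strong first-order letter ON `K` only —
# the windowed companion of `…ConstrainedValueSecondOrder` (global letter), in the window currency of `…ConstrainedSchurForm` §6 ∕
# `…ConstrainedValueWindow` (`{δ // δ ∈ K ∧ D δ = w}`) (row NE7b, node U5c; residual (R2′) family (2), letter (ℓ1) «`λ` ON `K`»; Mathlib only)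

Cell `pub-balaban`, sub-cell `t4`, spine estimate NE7b (`T4WeightBudget.RelWeightBound`; the cell's OWN estimate — NOT PRINTED in
[Bałaban 1983–89], NOT PROVED).  Crux-route work under `Spine/NE7b/` by a row leaf on the convexity road; NOTHING of Bałaban's is named
or asserted; no `T4Continuum/Support` leaf typed (FREEZE (0)); no `def`; zero `sorry`.  Imports: Mathlib only — independent of the farm's
`Spine/NE7b` olean frontier (so `…ConstrainedValueWindow`'s Fermat-on-the-window and bounded-below-on-`K` steps and
`…ConstrainedValueSecondOrder` §1's fibre-minimiser identity are used INLINE ∕ in map currency, never restated as declarations).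

WHY.  `…ConstrainedValueSecondOrder` (CVS, this lineage, p378453) proves the second-order expansion of `φ w = inf {V δ : D δ = w}` from
the strong first-order letter of `V` at `δ₀` on the WHOLE space (its chair's INFO ι-X-CVS-1: «the windowed road needs `K ∈ 𝓝 δ₀` only»;
the nonlinear companion `…ConstrainedValueLagrangian`'s chair, ι-3: «`hfoG` global; windowed consumers restrict»).  The road's exponents are
strongly convex on a WINDOW (print's small-field domains; (A3)), and this lineage's first-order files already come in the pair global ∕
windowed (`…ConstrainedValueDeriv` ∕ `…ConstrainedValueWindow`).  THIS FILE is the windowed second-order statement: every step of CVS is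
local in `h` — the competitor `δ₀ + N h` lies in `K` for small `h`, the far ∕ near split of the fibre of `w₀ + h` runs inside `K`, and the
expansion of `V` at `δ₀` is local by nature — so the strong letter is needed ON `K` ONLY, `K ∈ 𝓝 δ₀` arbitrary (not convex, not bounded).

WHAT IS PROVED ([folklore]; Fiacco (1983) §3.2 ∕ Bonnans–Shapiro (2000) §4.7 — localised; the Peano form is the two-competitor argument):
* §1 **`secondOrder_constrValue_window_upper`** — `K ∈ 𝓝 δ₀`, `V` bounded below on `K`, `δ₀` minimises `V` on `K ∩ {D δ = w₀}`, the
  upper second-order letter of `V` at `δ₀` ⊢ `∀ ε > 0`, eventually in `h → 0`: `φ_K (w₀ + h) ≤ φ_K w₀ + V′ (N h) + q (N h) + ε‖h‖²`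
  through ANY continuous linear right inverse `N` of `D` (the competitor `δ₀ + N h` is in `K` eventually).
* §2 `norm_sub_sq_le_of_firstOrderOn` (localisation inside `K`: strong letter ON `K` + `V′ ⊥ ker D` ⊢ `(m∕2)‖δ − δ₀‖² ≤ V δ − V δ₀ − V′ (N h)`
  for `δ ∈ K` over `w₀ + h`), `isMinOn_window_fibre_of_firstOrderOn` (`δ₀` minimises `V` on `K ∩ {D δ = w₀}`).
* §3 **`secondOrder_constrValue_window_lower`** — strong letter ON `K` (`m > 0`), `V′ ⊥ ker D`, `q ≤ c‖·‖²`, `N` a right inverse of `D`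
  minimising `q` on the fibres of `D` (`q (N (D v)) ≤ q v` — CSTF §3's `M`), the lower second-order letter of `V` at `δ₀` ⊢ `∀ ε > 0`,
  eventually: `φ_K w₀ + V′ (N h) + q (N h) ≤ φ_K (w₀ + h) + ε‖h‖²`.
* §4 THE END **`isLittleO_constrValue_window_secondOrder`** (with `V′ ⊥ ker D`) ∕ **`…_of_isMinOn`** (with the window-minimiser letter and
  `HasFDerivAt V V′ δ₀` — e.g. CVS's `hasFDerivAt_of_isLittleO_secondOrder`; Fermat on the window inline, as `…ConstrainedValueWindow` §1):
  `(h ↦ φ_K (w₀ + h) − φ_K w₀ − V′ (N h) − q (N h)) =o[𝓝 0] ‖h‖²` — the windowed value function's second-order term is `q ∘ N`, which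
  CVS §1 `constrInf_eq_apply_fibreMin` identifies with the constrained Schur form `q_D` (and `…ConstrainedValueHessian` §1 makes unique).
* §5 a non-vacuity `example` (`K = univ`, `D = N = id`).

NOT HERE (honest): the EXISTENCE of a window minimiser (`…ConstrainedValueWindow` §5, margin letter) and of `N` (CSTF §4); nonlinear
constraints on a window (`…ConstrainedValueLagrangian` is global in its strong letter — the same localisation applies, an append there);
`C²`-regularity of `φ_K`; which `V`, `D`, `K` of Bałaban's ((A3) ∕ (A1c), NC-NE7b-α UNRULED); any value.  BY-NAME EFFECT ON THE WALL: NONE.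
NE7b NOT PRINTED ∕ NOT PROVED; spine PROVED 0∕9; rung (B)+1 on a FINITE torus — NOT infinite volume, NOT the mass gap, NOT Clay.  HONEST
DEPENDENCY: continuum YM on T⁴ ⇐ BetaPertH ∧ nine spine estimates (0/9 proved); BetaPertH ⇐ (D1) ∧ (D4) ∧ CAP+tail; G-an2-4 gates asym,
D1 and NE2∕3∕4.
-/

set_option autoImplicit false

open Set Function Filter Asymptotics Metric
open scoped Topology

namespace Summit.QuantumFields.BalabanUV.T4Continuum.NE7b.ConstrainedValueWindowSecondOrder

section Window

variable {E F : Type*} [NormedAddCommGroup E] [NormedSpace ℝ E] [NormedAddCommGroup F] [NormedSpace ℝ F]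

/-! ## §1 The UPPER letter on a window: the competitor `δ₀ + N h` lies in `K` for small `h` -/

/-- **THE UPPER SECOND-ORDER LETTER OF THE WINDOWED VALUE FUNCTION.**  `K ∈ 𝓝 δ₀`, `V` bounded below on `K`, `δ₀` a minimiser of
`V` on `K ∩ {D δ = w₀}`, `N` a continuous linear right inverse of `D`, and the UPPER second-order letter of `V` at `δ₀`
(`∀ ε > 0`, eventually `V (δ₀ + v) ≤ V δ₀ + V′ v + q v + ε‖v‖²`) ⟹ `∀ ε > 0`, eventually in `h → 0`:
`φ_K (w₀ + h) ≤ φ_K w₀ + V′ (N h) + q (N h) + ε‖h‖²`, `φ_K w = ⨅ {V δ : δ ∈ K, D δ = w}`. [folklore] -/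
theorem secondOrder_constrValue_window_upper {V q : E → ℝ} {V' : E →L[ℝ] ℝ} {D : E →L[ℝ] F} {N : F →L[ℝ] E}
    (hN : ∀ w, D (N w) = w) {K : Set E} {w₀ : F} {δ₀ : E} (hK : K ∈ 𝓝 δ₀) (hbdd : ∃ m, ∀ δ ∈ K, m ≤ V δ) (hδ₀ : D δ₀ = w₀)
    (hmin : ∀ δ ∈ K, D δ = w₀ → V δ₀ ≤ V δ)
    (hV2u : ∀ ε : ℝ, 0 < ε → ∀ᶠ v in 𝓝 (0 : E), V (δ₀ + v) ≤ V δ₀ + V' v + q v + ε * ‖v‖ ^ 2)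
    {ε : ℝ} (hε : 0 < ε) :
    ∀ᶠ h in 𝓝 (0 : F), (⨅ δ : {δ // δ ∈ K ∧ D δ = w₀ + h}, V δ.1)
      ≤ (⨅ δ : {δ // δ ∈ K ∧ D δ = w₀}, V δ.1) + V' (N h) + q (N h) + ε * ‖h‖ ^ 2 := by
  have hδ₀K : δ₀ ∈ K := mem_of_mem_nhds hK
  obtain ⟨m, hm⟩ := hbdd
  have hbddV : ∀ w, BddBelow (range fun δ : {δ // δ ∈ K ∧ D δ = w} => V δ.1) :=
    fun w => ⟨m, forall_mem_range.2 fun δ => hm δ.1 δ.2.1⟩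
  have hφ0 : (⨅ δ : {δ // δ ∈ K ∧ D δ = w₀}, V δ.1) = V δ₀ :=
    haveI : Nonempty {δ // δ ∈ K ∧ D δ = w₀} := ⟨⟨δ₀, hδ₀K, hδ₀⟩⟩
    le_antisymm (ciInf_le (hbddV w₀) ⟨δ₀, hδ₀K, hδ₀⟩) (le_ciInf fun δ => hmin δ.1 δ.2.1 δ.2.2)
  have hε' : 0 < ε / (‖N‖ ^ 2 + 1) := div_pos hε (by positivity)
  -- pull the letter of `V` and the window back along `h ↦ N h` (resp. `h ↦ δ₀ + N h`)
  have hT : Tendsto (fun h : F => N h) (𝓝 0) (𝓝 0) := by simpa using N.continuous.tendsto (0 : F)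
  have hc : Continuous fun h : F => δ₀ + N h := continuous_const.add N.continuous
  have hTK : Tendsto (fun h : F => δ₀ + N h) (𝓝 0) (𝓝 δ₀) := by simpa using hc.tendsto (0 : F)
  filter_upwards [hT.eventually (hV2u _ hε'), hTK.eventually (show ∀ᶠ x in 𝓝 δ₀, x ∈ K from hK)] with h hh hhK
  have h1 : (⨅ δ : {δ // δ ∈ K ∧ D δ = w₀ + h}, V δ.1) ≤ V (δ₀ + N h) :=
    ciInf_le (hbddV _) ⟨δ₀ + N h, hhK, by rw [map_add, hδ₀, hN]⟩
  have hNh : ‖N h‖ ^ 2 ≤ ‖N‖ ^ 2 * ‖h‖ ^ 2 := by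
    rw [← mul_pow]; exact pow_le_pow_left₀ (norm_nonneg _) (N.le_opNorm h) 2
  have h2 : ε / (‖N‖ ^ 2 + 1) * ‖N h‖ ^ 2 ≤ ε * ‖h‖ ^ 2 :=
    calc ε / (‖N‖ ^ 2 + 1) * ‖N h‖ ^ 2 ≤ ε / (‖N‖ ^ 2 + 1) * ((‖N‖ ^ 2 + 1) * ‖h‖ ^ 2) :=
          mul_le_mul_of_nonneg_left (hNh.trans (by nlinarith [sq_nonneg ‖h‖])) hε'.le
      _ = ε * ‖h‖ ^ 2 := by rw [← mul_assoc, div_mul_cancel₀ _ (by positivity)]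
  rw [hφ0]
  linarith

/-! ## §2 Localisation inside the window -/

/-- **LOCALISATION INSIDE `K`.**  The strong first-order letter ON `K` and `V′ ⊥ ker D` ⟹ for `δ ∈ K` on the fibre of `w₀ + h`:
`(m∕2)‖δ − δ₀‖² ≤ V δ − V δ₀ − V′ (N h)` (the linear term is constant on fibres). [folklore] -/
theorem norm_sub_sq_le_of_firstOrderOn {V : E → ℝ} {V' : E →L[ℝ] ℝ} {D : E →L[ℝ] F} {N : F →L[ℝ] E} (hN : ∀ w, D (N w) = w)
    (hker : ∀ κ, D κ = 0 → V' κ = 0) {K : Set E} {m : ℝ} {δ₀ : E}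
    (hfo : ∀ δ ∈ K, V δ₀ + V' (δ - δ₀) + m / 2 * ‖δ - δ₀‖ ^ 2 ≤ V δ) {w₀ h : F} (hδ₀ : D δ₀ = w₀) {δ : E} (hδK : δ ∈ K)
    (hδ : D δ = w₀ + h) : m / 2 * ‖δ - δ₀‖ ^ 2 ≤ V δ - V δ₀ - V' (N h) := by
  have h0 := hker (δ - δ₀ - N h) (by rw [map_sub, map_sub, hδ, hδ₀, hN, add_sub_cancel_left, sub_self])
  rw [map_sub, sub_eq_zero] at h0
  have h1 := hfo δ hδK
  rw [h0] at h1
  linarith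

/-- On the window fibre `δ₀` is the minimiser (strong letter ON `K` + `V′ ⊥ ker D`). [folklore] -/
theorem isMinOn_window_fibre_of_firstOrderOn {V : E → ℝ} {V' : E →L[ℝ] ℝ} {D : E →L[ℝ] F} (hker : ∀ κ, D κ = 0 → V' κ = 0)
    {K : Set E} {m : ℝ} (hm : 0 ≤ m) {δ₀ : E} (hfo : ∀ δ ∈ K, V δ₀ + V' (δ - δ₀) + m / 2 * ‖δ - δ₀‖ ^ 2 ≤ V δ) {w₀ : F}
    (hδ₀ : D δ₀ = w₀) : ∀ δ ∈ K, D δ = w₀ → V δ₀ ≤ V δ := by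
  intro δ hδK hδ
  have h1 := hfo δ hδK
  rw [hker (δ - δ₀) (by rw [map_sub, hδ, hδ₀, sub_self])] at h1
  nlinarith [sq_nonneg ‖δ - δ₀‖]

/-! ## §3 The LOWER letter on a window: far fibre points of `K` by the strong letter, near ones by the expansion -/

/-- **THE LOWER SECOND-ORDER LETTER OF THE WINDOWED VALUE FUNCTION.**  `N` a continuous linear right inverse of `D` minimising the
form `q` on the fibres of `D` (`q (N (D v)) ≤ q v`), `D δ₀ = w₀`, `V′ ⊥ ker D`, the STRONG first-order letter ON `K` with `m > 0`,
`q ≤ c‖·‖²` (no sign condition: the window version never forms `q_D`), and the LOWER second-order letter of `V` at `δ₀` ⟹ `∀ ε > 0`, eventually in `h → 0`: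
`φ_K w₀ + V′ (N h) + q (N h) ≤ φ_K (w₀ + h) + ε‖h‖²`.  Proof as in CVS §4, inside `K`: a point `δ ∈ K` of the fibre of `w₀ + h` with
`‖δ − δ₀‖ > A‖h‖` (`A = 2c₊‖N‖²∕m + 1`) obeys `V δ ≥ V δ₀ + V′ (N h) + c₊‖N‖²‖h‖² ≥ … + q (N h)`; one with `‖δ − δ₀‖ ≤ A‖h‖` is in the
expansion's ball once `‖h‖ < r∕A`, and `q (δ − δ₀) ≥ q (N h)`.  (`K ∈ 𝓝 δ₀` enters only to put `δ₀ + N h` in `K` for small `h`,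
so that the window fibre of `w₀ + h` is non-empty and its infimum is not the junk value `0`.) [folklore] -/
theorem secondOrder_constrValue_window_lower {V q : E → ℝ} {V' : E →L[ℝ] ℝ} {D : E →L[ℝ] F} {N : F →L[ℝ] E}
    (hN : ∀ w, D (N w) = w) (hNmin : ∀ v, q (N (D v)) ≤ q v) {K : Set E} {w₀ : F} {δ₀ : E} (hK : K ∈ 𝓝 δ₀) (hδ₀ : D δ₀ = w₀)
    (hker : ∀ κ, D κ = 0 → V' κ = 0) {m : ℝ} (hm : 0 < m) (hfo : ∀ δ ∈ K, V δ₀ + V' (δ - δ₀) + m / 2 * ‖δ - δ₀‖ ^ 2 ≤ V δ)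
    {c : ℝ} (hqc : ∀ v, q v ≤ c * ‖v‖ ^ 2)
    (hV2l : ∀ ε : ℝ, 0 < ε → ∀ᶠ v in 𝓝 (0 : E), V δ₀ + V' v + q v ≤ V (δ₀ + v) + ε * ‖v‖ ^ 2)
    {ε : ℝ} (hε : 0 < ε) :
    ∀ᶠ h in 𝓝 (0 : F), (⨅ δ : {δ // δ ∈ K ∧ D δ = w₀}, V δ.1) + V' (N h) + q (N h)
      ≤ (⨅ δ : {δ // δ ∈ K ∧ D δ = w₀ + h}, V δ.1) + ε * ‖h‖ ^ 2 := by
  have hδ₀K : δ₀ ∈ K := mem_of_mem_nhds hK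
  set cp : ℝ := max c 0 with hcp
  have hcp0 : 0 ≤ cp := le_max_right _ _
  have hqcp : ∀ v, q v ≤ cp * ‖v‖ ^ 2 := fun v => (hqc v).trans (by gcongr; exact le_max_left _ _)
  set A : ℝ := 2 * cp * ‖N‖ ^ 2 / m + 1 with hA
  have hA1 : 1 ≤ A := by linarith [(by positivity : 0 ≤ 2 * cp * ‖N‖ ^ 2 / m)]
  have hApos : 0 < A := by linarith
  have hε' : 0 < ε / A ^ 2 := by positivity
  obtain ⟨r, hr, hball⟩ := Metric.eventually_nhds_iff.1 (hV2l _ hε')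
  have hbdd0 : BddBelow (range fun δ : {δ // δ ∈ K ∧ D δ = w₀} => V δ.1) :=
    ⟨V δ₀, forall_mem_range.2 fun δ => isMinOn_window_fibre_of_firstOrderOn hker hm.le hfo hδ₀ δ.1 δ.2.1 δ.2.2⟩
  have hφ0 : (⨅ δ : {δ // δ ∈ K ∧ D δ = w₀}, V δ.1) ≤ V δ₀ := ciInf_le hbdd0 ⟨δ₀, hδ₀K, hδ₀⟩
  have hc : Continuous fun h : F => δ₀ + N h := continuous_const.add N.continuous
  have hTK : Tendsto (fun h : F => δ₀ + N h) (𝓝 0) (𝓝 δ₀) := by simpa using hc.tendsto (0 : F)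
  have hballF : ∀ᶠ h in 𝓝 (0 : F), ‖h‖ < r / A :=
    Metric.eventually_nhds_iff.2 ⟨r / A, div_pos hr hApos, fun h hh => by rwa [dist_zero_right] at hh⟩
  filter_upwards [hballF, hTK.eventually (show ∀ᶠ x in 𝓝 δ₀, x ∈ K from hK)] with h hh hhK
  haveI : Nonempty {δ // δ ∈ K ∧ D δ = w₀ + h} := ⟨⟨δ₀ + N h, hhK, by rw [map_add, hδ₀, hN]⟩⟩
  have hqN : q (N h) ≤ cp * ‖N‖ ^ 2 * ‖h‖ ^ 2 := by
    have hNh : ‖N h‖ ^ 2 ≤ ‖N‖ ^ 2 * ‖h‖ ^ 2 := by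
      rw [← mul_pow]; exact pow_le_pow_left₀ (norm_nonneg _) (N.le_opNorm h) 2
    exact (hqcp (N h)).trans (by rw [mul_assoc]; exact mul_le_mul_of_nonneg_left hNh hcp0)
  have key : ∀ δ : {δ // δ ∈ K ∧ D δ = w₀ + h}, V δ₀ + V' (N h) + q (N h) - ε * ‖h‖ ^ 2 ≤ V δ.1 := by
    rintro ⟨δ, hδK, hδ⟩
    have hv : D (δ - δ₀) = h := by rw [map_sub, hδ, hδ₀, add_sub_cancel_left]
    have hstrong : m / 2 * ‖δ - δ₀‖ ^ 2 ≤ V δ - V δ₀ - V' (N h) := norm_sub_sq_le_of_firstOrderOn hN hker hfo hδ₀ hδK hδ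
    have hεh : 0 ≤ ε * ‖h‖ ^ 2 := by positivity
    by_cases hcase : A * ‖h‖ < ‖δ - δ₀‖
    · -- far from `δ₀` (inside `K`): the strong letter alone
      have h1 : A * ‖h‖ ^ 2 ≤ ‖δ - δ₀‖ ^ 2 := by
        have h1a : (A * ‖h‖) ^ 2 ≤ ‖δ - δ₀‖ ^ 2 := pow_le_pow_left₀ (by positivity) hcase.le 2
        have h1b : A * ‖h‖ ^ 2 ≤ (A * ‖h‖) ^ 2 := by
          rw [mul_pow]; exact mul_le_mul_of_nonneg_right (by nlinarith) (sq_nonneg _)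
        exact h1b.trans h1a
      have h2 : m / 2 * (A * ‖h‖ ^ 2) = (cp * ‖N‖ ^ 2 + m / 2) * ‖h‖ ^ 2 := by rw [hA]; field_simp
      have h3a : m / 2 * (A * ‖h‖ ^ 2) ≤ m / 2 * ‖δ - δ₀‖ ^ 2 := mul_le_mul_of_nonneg_left h1 (by positivity)
      have h3b : 0 ≤ m / 2 * ‖h‖ ^ 2 := by positivity
      simp only
      linarith
    · -- near `δ₀`: the lower expansion and the fibre-minimiser letter
      rw [not_lt] at hcase
      have hsmall : dist (δ - δ₀) 0 < r := by
        rw [dist_zero_right]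
        calc ‖δ - δ₀‖ ≤ A * ‖h‖ := hcase
          _ < A * (r / A) := by gcongr
          _ = r := mul_div_cancel₀ _ hApos.ne'
      have hexp := hball hsmall
      have hlin : V' (δ - δ₀) = V' (N h) := by
        have h0 := hker (δ - δ₀ - N h) (by rw [map_sub, hv, hN, sub_self])
        rwa [map_sub, sub_eq_zero] at h0
      rw [add_sub_cancel, hlin] at hexp
      have hqv : q (N h) ≤ q (δ - δ₀) := by simpa only [hv] using hNmin (δ - δ₀)
      have hε'le : ε / A ^ 2 * ‖δ - δ₀‖ ^ 2 ≤ ε * ‖h‖ ^ 2 := by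
        have h4 : ‖δ - δ₀‖ ^ 2 ≤ A ^ 2 * ‖h‖ ^ 2 := by
          rw [← mul_pow]; exact pow_le_pow_left₀ (norm_nonneg _) hcase 2
        calc ε / A ^ 2 * ‖δ - δ₀‖ ^ 2 ≤ ε / A ^ 2 * (A ^ 2 * ‖h‖ ^ 2) := mul_le_mul_of_nonneg_left h4 hε'.le
          _ = ε * ‖h‖ ^ 2 := by rw [← mul_assoc, div_mul_cancel₀ _ (by positivity)]
      simp only
      linarith
  linarith [le_ciInf key]

/-! ## §4 THE END on a window: quadratic term `q ∘ N` (= the constrained Schur form `q_D`, CVS §1) -/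

/-- **THE SECOND-ORDER ENVELOPE THEOREM ON A WINDOW (Peano form).**  `K ∈ 𝓝 δ₀`; `N : F →L E` a right inverse of `D` minimising the
form `q` on the fibres of `D`; `D δ₀ = w₀`; `V′ ⊥ ker D`; the STRONG first-order letter of `V` ON `K` with `m > 0`; `q ≤ c‖·‖²`;
the second-order expansion `(v ↦ V (δ₀ + v) − V δ₀ − V′ v − q v) =o[𝓝 0] ‖v‖²` ⟹
`(h ↦ φ_K (w₀ + h) − φ_K w₀ − V′ (N h) − q (N h)) =o[𝓝 0] ‖h‖²`, `φ_K w = ⨅ {V δ : δ ∈ K, D δ = w}` — the windowed value function has the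
same second-order term `q ∘ N = q_D` as the global one (CVS §5); the window enters only through `K ∈ 𝓝 δ₀`. [folklore] -/
theorem isLittleO_constrValue_window_secondOrder {V q : E → ℝ} {V' : E →L[ℝ] ℝ} {D : E →L[ℝ] F} {N : F →L[ℝ] E}
    (hN : ∀ w, D (N w) = w) (hNmin : ∀ v, q (N (D v)) ≤ q v) {K : Set E} {w₀ : F} {δ₀ : E} (hK : K ∈ 𝓝 δ₀) (hδ₀ : D δ₀ = w₀)
    (hker : ∀ κ, D κ = 0 → V' κ = 0) {m : ℝ} (hm : 0 < m) (hfo : ∀ δ ∈ K, V δ₀ + V' (δ - δ₀) + m / 2 * ‖δ - δ₀‖ ^ 2 ≤ V δ)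
    {c : ℝ} (hqc : ∀ v, q v ≤ c * ‖v‖ ^ 2)
    (hV2 : (fun v => V (δ₀ + v) - V δ₀ - V' v - q v) =o[𝓝 (0 : E)] fun v => ‖v‖ ^ 2) :
    (fun h => (⨅ δ : {δ // δ ∈ K ∧ D δ = w₀ + h}, V δ.1) - (⨅ δ : {δ // δ ∈ K ∧ D δ = w₀}, V δ.1) - V' (N h) - q (N h))
      =o[𝓝 (0 : F)] fun h => ‖h‖ ^ 2 := by
  -- bounded below ON `K` from the strong letter (as `…ConstrainedValueWindow.bddBelowOn_of_firstOrderOn`; no olean to import yet)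
  have hbdd : ∃ c, ∀ δ ∈ K, c ≤ V δ := by
    refine ⟨V δ₀ - ‖V'‖ ^ 2 / (2 * m), fun δ hδK => ?_⟩
    have h1 : -(‖V'‖ * ‖δ - δ₀‖) ≤ V' (δ - δ₀) := by
      have h := V'.le_opNorm (δ - δ₀)
      rw [Real.norm_eq_abs] at h
      linarith [neg_abs_le (V' (δ - δ₀))]
    have h2 : 0 ≤ ‖V'‖ ^ 2 / (2 * m) + m / 2 * ‖δ - δ₀‖ ^ 2 - ‖V'‖ * ‖δ - δ₀‖ := by
      have h3 : ‖V'‖ ^ 2 / (2 * m) + m / 2 * ‖δ - δ₀‖ ^ 2 - ‖V'‖ * ‖δ - δ₀‖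
          = (‖V'‖ - m * ‖δ - δ₀‖) ^ 2 / (2 * m) := by
        field_simp
        ring
      rw [h3]
      positivity
    linarith [hfo δ hδK]
  have hmin : ∀ δ ∈ K, D δ = w₀ → V δ₀ ≤ V δ := isMinOn_window_fibre_of_firstOrderOn hker hm.le hfo hδ₀
  have hside : ∀ {ε' : ℝ}, 0 < ε' → ∀ᶠ v in 𝓝 (0 : E),
      V (δ₀ + v) ≤ V δ₀ + V' v + q v + ε' * ‖v‖ ^ 2 ∧ V δ₀ + V' v + q v ≤ V (δ₀ + v) + ε' * ‖v‖ ^ 2 := by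
    intro ε' hε'
    filter_upwards [hV2.def hε'] with v hv
    rw [Real.norm_eq_abs, Real.norm_of_nonneg (by positivity), abs_le] at hv
    constructor <;> linarith [hv.1, hv.2]
  refine isLittleO_iff.2 fun ε hε => ?_
  have hu := secondOrder_constrValue_window_upper (q := q) hN hK hbdd hδ₀ hmin
    (fun ε' hε' => (hside hε').mono fun v hv => hv.1) hε
  have hl := secondOrder_constrValue_window_lower hN hNmin hK hδ₀ hker hm hfo hqc
    (fun ε' hε' => (hside hε').mono fun v hv => hv.2) hε
  filter_upwards [hu, hl] with h hhu hhl
  rw [Real.norm_eq_abs, Real.norm_of_nonneg (by positivity), abs_le]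
  constructor <;> linarith

/-- **THE END ON A WINDOW, FROM THE WINDOW-MINIMISER LETTER**: as `isLittleO_constrValue_window_secondOrder`, with `V′ ⊥ ker D` replaced
by «`δ₀` minimises `V` on `K ∩ {D δ = w₀}`» and `HasFDerivAt V V′ δ₀` (which the expansion supplies — CVS's
`hasFDerivAt_of_isLittleO_secondOrder`): Fermat on the fibre needs only `K ∈ 𝓝 δ₀` (the line `δ₀ + tκ` stays in the fibre and, for
small `t`, in `K` — `…ConstrainedValueWindow` §1, inline). [folklore] -/
theorem isLittleO_constrValue_window_secondOrder_of_isMinOn {V q : E → ℝ} {V' : E →L[ℝ] ℝ} {D : E →L[ℝ] F} {N : F →L[ℝ] E}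
    (hN : ∀ w, D (N w) = w) (hNmin : ∀ v, q (N (D v)) ≤ q v) {K : Set E} {w₀ : F} {δ₀ : E} (hK : K ∈ 𝓝 δ₀) (hδ₀ : D δ₀ = w₀)
    (hmin : ∀ δ ∈ K, D δ = w₀ → V δ₀ ≤ V δ) (hV : HasFDerivAt V V' δ₀) {m : ℝ} (hm : 0 < m)
    (hfo : ∀ δ ∈ K, V δ₀ + V' (δ - δ₀) + m / 2 * ‖δ - δ₀‖ ^ 2 ≤ V δ)
    {c : ℝ} (hqc : ∀ v, q v ≤ c * ‖v‖ ^ 2)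
    (hV2 : (fun v => V (δ₀ + v) - V δ₀ - V' v - q v) =o[𝓝 (0 : E)] fun v => ‖v‖ ^ 2) :
    (fun h => (⨅ δ : {δ // δ ∈ K ∧ D δ = w₀ + h}, V δ.1) - (⨅ δ : {δ // δ ∈ K ∧ D δ = w₀}, V δ.1) - V' (N h) - q (N h))
      =o[𝓝 (0 : F)] fun h => ‖h‖ ^ 2 := by
  have hker : ∀ κ, D κ = 0 → V' κ = 0 := by
    intro κ hκ
    have hline : HasDerivAt (fun t : ℝ => δ₀ + t • κ) κ 0 := by
      simpa using ((hasDerivAt_id (0 : ℝ)).smul_const κ).const_add δ₀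
    have hV0 : HasFDerivAt V V' (δ₀ + (0 : ℝ) • κ) := by simpa using hV
    have hc : Continuous fun t : ℝ => δ₀ + t • κ := continuous_const.add (continuous_id.smul continuous_const)
    have hcont : Tendsto (fun t : ℝ => δ₀ + t • κ) (𝓝 0) (𝓝 δ₀) := by simpa using hc.tendsto (0 : ℝ)
    have hloc : IsLocalMin (V ∘ fun t : ℝ => δ₀ + t • κ) 0 := by
      filter_upwards [hcont.eventually (show ∀ᶠ x in 𝓝 δ₀, x ∈ K from hK)] with t ht
      simpa using hmin (δ₀ + t • κ) ht (by rw [map_add, map_smul, hκ, smul_zero, add_zero, hδ₀])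
    exact hloc.hasDerivAt_eq_zero (hV0.comp_hasDerivAt (0 : ℝ) hline)
  exact isLittleO_constrValue_window_secondOrder hN hNmin hK hδ₀ hker hm hfo hqc hV2

end Window

/-! ## §5 Toy check (kernel): `K = univ`, `D = N = id` — the END returns `V`'s own expansion -/

example {E : Type*} [NormedAddCommGroup E] [NormedSpace ℝ E] {V q : E → ℝ} {V' : E →L[ℝ] ℝ} {δ₀ : E}
    (hker : ∀ κ, (ContinuousLinearMap.id ℝ E) κ = 0 → V' κ = 0) {m : ℝ} (hm : 0 < m)
    (hfo : ∀ δ ∈ (univ : Set E), V δ₀ + V' (δ - δ₀) + m / 2 * ‖δ - δ₀‖ ^ 2 ≤ V δ) {c : ℝ}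
    (hqc : ∀ v, q v ≤ c * ‖v‖ ^ 2) (hV2 : (fun v => V (δ₀ + v) - V δ₀ - V' v - q v) =o[𝓝 (0 : E)] fun v => ‖v‖ ^ 2) :
    (fun h => (⨅ δ : {δ // δ ∈ (univ : Set E) ∧ (ContinuousLinearMap.id ℝ E) δ = δ₀ + h}, V δ.1)
        - (⨅ δ : {δ // δ ∈ (univ : Set E) ∧ (ContinuousLinearMap.id ℝ E) δ = δ₀}, V δ.1)
        - V' ((ContinuousLinearMap.id ℝ E) h) - q ((ContinuousLinearMap.id ℝ E) h)) =o[𝓝 (0 : E)] fun h => ‖h‖ ^ 2 :=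
  isLittleO_constrValue_window_secondOrder (D := ContinuousLinearMap.id ℝ E) (N := ContinuousLinearMap.id ℝ E)
    (fun _ => rfl) (fun _ => le_rfl) univ_mem rfl hker hm hfo hqc hV2

end Summit.QuantumFields.BalabanUV.T4Continuum.NE7b.ConstrainedValueWindowSecondOrder
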